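import Mathlib.NumberTheory.NumberField.Cyclotomic.Ideal
import Literature.NumberTheory.EllipticCurves.HeegnerPoints
import Literature.NumberTheory.EllipticCurves.HeegnerPointsImaginaryQuadraticProofs
import HarnessLib

/-!
# The Heegner hypothesis over `ℚ(√−3)` and `ℚ(i)`: worked instances and a non-example

`Literature.SatisfiesHeegnerHypothesis N K` (file `HeegnerPoints`) is the **Heegner hypothesis**: every
prime `p ∣ N` splits in the (imaginary quadratic) field `K` — Gross 1991, §1 (p. 235) "where all
prime factors of `N` are split"; Darmon 2004, Hypothesis 3.9. It is a *hypothesis on the pair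
`(N, K)`*, not a theorem; this file makes that precise for the two classical CM fields, presented
as cyclotomic fields so that Mathlib's splitting results for `ℚ(ζₘ)` apply
(`IsCyclotomicExtension.Rat.ncard_primesOver_of_prime(_pow)`,
`IsCyclotomicExtension.Rat.inertiaDegIn_eq_of_not_dvd`, `…ramificationIdxIn_eq_of_not_dvd`);
it is the `SatisfiesHeegnerHypothesis` companion of `HeegnerPointsImaginaryQuadraticProofs`
(which does the same for the predicate `IsImaginaryQuadratic`):

* `ncard_primesOver_mul_orderOf_of_isCyclotomicExtension`: for `p ∤ m` the number `g` of primes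
  of `ℚ(ζₘ)` above `p` satisfies `g · f = φ(m)` with `f = ord_m(p)` (Ireland–Rosen, Ch. 13, §2,
  Thm. 2: "`(p) = P₁ ⋯ P_g`, each `Pᵢ` of degree `f`, `g = φ(m)/f`").
* For `K = ℚ(ζ₃) = ℚ(√−3)` (`IsCyclotomicExtension {3} ℚ K`) and `K = ℚ(ζ₄) = ℚ(i)`
  (`IsCyclotomicExtension {4} ℚ K`) — imaginary quadratic fields, see
  `Literature.isImaginaryQuadratic_of_isCyclotomicExtension_three/_four` in
  `HeegnerPointsImaginaryQuadraticProofs` — a prime `p` has two primes of `𝓞 K` above it iff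
  `p ≡ 1 (mod 3)`, resp. `p ≡ 1 (mod 4)` (the ramified prime `3`, resp. `2`, and the inert
  primes have one); hence `SatisfiesHeegnerHypothesis N K ↔ ∀ p ∣ N prime, p ≡ 1 (mod 3)`
  (resp. `mod 4`).
* Consequences: the hypothesis fails for `ℚ(√−3)` as soon as `3 ∣ N` and for `ℚ(i)` as soon as
  `2 ∣ N`, holds for `(7, ℚ(√−3))` and `(5, ℚ(i))`;
  `exists_isImaginaryQuadratic_and_not_satisfiesHeegnerHypothesis` records an imaginary
  quadratic field (`CyclotomicField 3 ℚ`) for which it holds at level `7` and fails at level `3`,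
  and `not_forall_satisfiesHeegnerHypothesis` is the formal reason why the predicate has no
  discharge `SatisfiesHeegnerHypothesis_holds`: its closure over levels `N ≥ 1` and imaginary
  quadratic `K` is false — it is a genuine hypothesis, as in the sources (companion of
  `Literature.NumberTheory.EllipticCurves.not_forall_isImaginaryQuadratic`).

Everything here is proved (no named facts).

## References

* B. H. Gross, *Kolyvagin's work on modular elliptic curves*, in *`L`-functions and arithmetic
  (Durham, 1989)*, LMS Lecture Note Ser. 153 (1991), 235–256, §1.
* H. Darmon, *Rational points on modular elliptic curves*, CBMS 101 (2004), §3.4, Prop. 3.8,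
  Hypothesis 3.9.
* K. Ireland, M. Rosen, *A classical introduction to modern number theory*, GTM 84 (1982),
  Ch. 13: Prop. 13.1.3–13.1.4 (decomposition in quadratic fields), §2 Thm. 2 and Prop. 13.2.7
  (decomposition in cyclotomic fields).
-/

noncomputable section

open NumberField Ideal

universe u

namespace Literature.NumberTheory.EllipticCurves

variable (K : Type u) [Field K] [NumberField K]

/-! ### Decomposition of unramified primes in `ℚ(ζₘ)` -/

/-- **Decomposition of `p ∤ m` in `ℚ(ζₘ)`** (Ireland–Rosen, Ch. 13, §2, Thm. 2): the number `g` of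
primes of `𝓞 K` above `p` and the order `f` of `p` in `(ℤ/mℤ)ˣ` satisfy `g · f = φ(m)`; here from
Mathlib's fundamental identity `g · (e · f) = [K : ℚ]`
(`Ideal.ncard_primesOver_mul_ramificationIdxIn_mul_inertiaDegIn`) with `e = 1`,
`f = orderOf (p : ZMod m)` (`IsCyclotomicExtension.Rat.ramificationIdxIn_eq_of_not_dvd`,
`…inertiaDegIn_eq_of_not_dvd`) and `[K : ℚ] = φ(m)`.
[cite: IrelandRosen1982, Ch. 13 §2 Thm. 2] -/
theorem ncard_primesOver_mul_orderOf_of_isCyclotomicExtension (m : ℕ) [NeZero m]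
    [IsCyclotomicExtension {m} ℚ K] {p : ℕ} (hp : p.Prime) (hpm : ¬ p ∣ m) :
    ((Ideal.span {(p : ℤ)}).primesOver (𝓞 K)).ncard * orderOf (p : ZMod m) = m.totient := by
  have : Fact p.Prime := ⟨hp⟩
  have : IsGalois ℚ K := IsCyclotomicExtension.isGalois {m} ℚ K
  have h := Ideal.ncard_primesOver_mul_ramificationIdxIn_mul_inertiaDegIn
    (Ideal.span {(p : ℤ)}) (𝓞 K) Gal(K/ℚ)
  rwa [IsCyclotomicExtension.Rat.ramificationIdxIn_eq_of_not_dvd p K hpm,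
    IsCyclotomicExtension.Rat.inertiaDegIn_eq_of_not_dvd p K hpm, one_mul,
    IsGaloisGroup.card_eq_finrank Gal(K/ℚ) ℚ K, IsCyclotomicExtension.Rat.finrank m K] at h

/-! ### Which primes split -/

/-- **Splitting in `ℚ(√−3)`.** A prime `p` has exactly two primes of `𝓞 K` above it,
`K = ℚ(ζ₃)`, iff `p ≡ 1 (mod 3)`: `3` is totally ramified (one prime,
`IsCyclotomicExtension.Rat.ncard_primesOver_of_prime`), and for `p ≠ 3` the number of primes is
`φ(3) / ord₃(p) = 2 / ord₃(p)` (`ncard_primesOver_mul_orderOf_of_isCyclotomicExtension`), which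
is `2` iff `p ≡ 1 (mod 3)` (Ireland–Rosen, Prop. 13.1.3 with `d = −3`, and Ch. 13 §2 Thm. 2,
Prop. 13.2.7). [cite: IrelandRosen1982, Prop. 13.1.3 and Ch. 13 §2 Thm. 2] -/
theorem ncard_primesOver_eq_two_iff_of_isCyclotomicExtension_three
    [IsCyclotomicExtension {3} ℚ K] {p : ℕ} (hp : p.Prime) :
    ((Ideal.span {(p : ℤ)}).primesOver (𝓞 K)).ncard = 2 ↔ p % 3 = 1 := by
  by_cases hp3 : p = 3
  · subst hp3
    have : Fact (Nat.Prime 3) := ⟨hp⟩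
    rw [IsCyclotomicExtension.Rat.ncard_primesOver_of_prime 3 K]
    decide
  have hpm : ¬ p ∣ 3 := fun h ↦ hp3 ((Nat.prime_dvd_prime_iff_eq hp Nat.prime_three).mp h)
  have h := ncard_primesOver_mul_orderOf_of_isCyclotomicExtension K 3 hp hpm
  rw [Nat.totient_prime Nat.prime_three] at h
  have hx : (p : ZMod 3) = 1 ↔ p % 3 = 1 := by
    simpa using ZMod.natCast_eq_natCast_iff' p 1 3
  rw [← hx, ← orderOf_eq_one_iff]
  constructor
  · intro h2
    rw [h2] at h
    omega
  · intro h1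
    rw [h1, mul_one] at h
    exact h

/-- **Splitting in `ℚ(i)`.** A prime `p` has exactly two primes of `𝓞 K` above it, `K = ℚ(ζ₄)`,
iff `p ≡ 1 (mod 4)`: `2` is totally ramified in `ℚ(ζ_{2²})` (one prime,
`IsCyclotomicExtension.Rat.ncard_primesOver_of_prime_pow`), and for odd `p` the number of primes
is `φ(4) / ord₄(p) = 2 / ord₄(p)`, which is `2` iff `p ≡ 1 (mod 4)` (Ireland–Rosen, Prop. 13.1.3–
13.1.4 with `d = −1`, and Ch. 13 §2 Thm. 2).
[cite: IrelandRosen1982, Prop. 13.1.3–13.1.4 and Ch. 13 §2 Thm. 2] -/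
theorem ncard_primesOver_eq_two_iff_of_isCyclotomicExtension_four
    [IsCyclotomicExtension {4} ℚ K] {p : ℕ} (hp : p.Prime) :
    ((Ideal.span {(p : ℤ)}).primesOver (𝓞 K)).ncard = 2 ↔ p % 4 = 1 := by
  by_cases hp2 : p = 2
  · subst hp2
    have : Fact (Nat.Prime 2) := ⟨hp⟩
    have : IsCyclotomicExtension {2 ^ (1 + 1)} ℚ K := by norm_num; infer_instance
    rw [IsCyclotomicExtension.Rat.ncard_primesOver_of_prime_pow 2 1 K]
    decide
  have hpm : ¬ p ∣ 4 := fun h ↦ hp2 ((Nat.prime_dvd_prime_iff_eq hp Nat.prime_two).mp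
    (hp.dvd_of_dvd_pow (n := 2) (by norm_num at h ⊢; exact h)))
  have h := ncard_primesOver_mul_orderOf_of_isCyclotomicExtension K 4 hp hpm
  rw [show Nat.totient 4 = 2 by decide] at h
  have hx : (p : ZMod 4) = 1 ↔ p % 4 = 1 := by
    simpa using ZMod.natCast_eq_natCast_iff' p 1 4
  rw [← hx, ← orderOf_eq_one_iff]
  constructor
  · intro h2
    rw [h2] at h
    omega
  · intro h1
    rw [h1, mul_one] at h
    exact h

/-! ### The Heegner hypothesis over `ℚ(√−3)` and `ℚ(i)` -/

/-- **The Heegner hypothesis over `ℚ(√−3)`** (Gross 1991, §1; Darmon 2004, Hypothesis 3.9, made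
explicit with Ireland–Rosen, Prop. 13.1.3): `(N, ℚ(ζ₃))` satisfies the Heegner hypothesis iff every
prime factor of `N` is `≡ 1 (mod 3)`. [cite: Darmon2004, Hypothesis 3.9] -/
theorem satisfiesHeegnerHypothesis_iff_of_isCyclotomicExtension_three
    [IsCyclotomicExtension {3} ℚ K] {N : ℕ} :
    SatisfiesHeegnerHypothesis N K ↔ ∀ p : ℕ, p.Prime → p ∣ N → p % 3 = 1 :=
  forall_congr' fun _ ↦ forall_congr' fun hp ↦ forall_congr' fun _ ↦
    ncard_primesOver_eq_two_iff_of_isCyclotomicExtension_three K hp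

/-- **The Heegner hypothesis over `ℚ(i)`** (Gross 1991, §1; Darmon 2004, Hypothesis 3.9, made
explicit with Ireland–Rosen, Prop. 13.1.3–13.1.4): `(N, ℚ(ζ₄))` satisfies the Heegner hypothesis
iff every prime factor of `N` is `≡ 1 (mod 4)`. [cite: Darmon2004, Hypothesis 3.9] -/
theorem satisfiesHeegnerHypothesis_iff_of_isCyclotomicExtension_four
    [IsCyclotomicExtension {4} ℚ K] {N : ℕ} :
    SatisfiesHeegnerHypothesis N K ↔ ∀ p : ℕ, p.Prime → p ∣ N → p % 4 = 1 :=
  forall_congr' fun _ ↦ forall_congr' fun hp ↦ forall_congr' fun _ ↦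
    ncard_primesOver_eq_two_iff_of_isCyclotomicExtension_four K hp

/-- Non-example: the Heegner hypothesis fails for `K = ℚ(√−3)` at every level divisible by `3`
(`3` ramifies in `K`; Darmon 2004, Prop. 3.8 / Hypothesis 3.9). [folklore] -/
theorem not_satisfiesHeegnerHypothesis_of_isCyclotomicExtension_three
    [IsCyclotomicExtension {3} ℚ K] {N : ℕ} (hN : 3 ∣ N) : ¬ SatisfiesHeegnerHypothesis N K :=
  fun h ↦ by simpa using
    (satisfiesHeegnerHypothesis_iff_of_isCyclotomicExtension_three K).mp h 3 Nat.prime_three hN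

/-- Non-example: the Heegner hypothesis fails for `K = ℚ(i)` at every even level (`2` ramifies in
`K`; Darmon 2004, Prop. 3.8 / Hypothesis 3.9). [folklore] -/
theorem not_satisfiesHeegnerHypothesis_of_isCyclotomicExtension_four
    [IsCyclotomicExtension {4} ℚ K] {N : ℕ} (hN : 2 ∣ N) : ¬ SatisfiesHeegnerHypothesis N K :=
  fun h ↦ by simpa using
    (satisfiesHeegnerHypothesis_iff_of_isCyclotomicExtension_four K).mp h 2 Nat.prime_two hN

/-- Example: `(7, ℚ(√−3))` satisfies the Heegner hypothesis (`7 ≡ 1 (mod 3)` splits;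
Darmon 2004, Hypothesis 3.9). [folklore] -/
theorem satisfiesHeegnerHypothesis_seven_of_isCyclotomicExtension_three
    [IsCyclotomicExtension {3} ℚ K] : SatisfiesHeegnerHypothesis 7 K :=
  (satisfiesHeegnerHypothesis_iff_of_isCyclotomicExtension_three K).mpr fun p hp hp7 ↦ by
    rw [(Nat.prime_dvd_prime_iff_eq hp (by norm_num)).mp hp7]

/-- Example: `(5, ℚ(i))` satisfies the Heegner hypothesis (`5 ≡ 1 (mod 4)` splits;
Darmon 2004, Hypothesis 3.9). [folklore] -/
theorem satisfiesHeegnerHypothesis_five_of_isCyclotomicExtension_four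
    [IsCyclotomicExtension {4} ℚ K] : SatisfiesHeegnerHypothesis 5 K :=
  (satisfiesHeegnerHypothesis_iff_of_isCyclotomicExtension_four K).mpr fun p hp hp5 ↦ by
    rw [(Nat.prime_dvd_prime_iff_eq hp (by norm_num)).mp hp5]

/-- **The Heegner hypothesis is a genuine hypothesis.** There is an imaginary quadratic field
(`K = CyclotomicField 3 ℚ = ℚ(√−3)`) for which the Heegner hypothesis holds at level `7` and
fails at level `3`; in particular neither `∀ N K, SatisfiesHeegnerHypothesis N K` nor its negation
holds over imaginary quadratic fields, matching its role as a standing assumption in Gross 1991,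
§1 and Darmon 2004, Hypothesis 3.9. [folklore] -/
theorem exists_isImaginaryQuadratic_and_not_satisfiesHeegnerHypothesis :
    ∃ (K : Type) (_ : Field K) (_ : NumberField K),
      IsImaginaryQuadratic K ∧ SatisfiesHeegnerHypothesis 7 K ∧
        ¬ SatisfiesHeegnerHypothesis 3 K :=
  haveI : NeZero ((3 : ℕ) : ℚ) := ⟨by norm_num⟩
  -- the `Algebra ℚ _` diamond (`DivisionRing.toRatAlgebra` vs the splitting-field algebra) is
  -- only a defeq at default transparency, so instance search needs the instance restated:
  haveI : IsCyclotomicExtension {3} ℚ (CyclotomicField 3 ℚ) :=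
    CyclotomicField.isCyclotomicExtension 3 ℚ
  ⟨CyclotomicField 3 ℚ, inferInstance, inferInstance,
    isImaginaryQuadratic_cyclotomicField_three,
    satisfiesHeegnerHypothesis_seven_of_isCyclotomicExtension_three _,
    not_satisfiesHeegnerHypothesis_of_isCyclotomicExtension_three _ dvd_rfl⟩

/-- **Why there is no `SatisfiesHeegnerHypothesis_holds`.** The closure of the Heegner
hypothesis over positive levels and imaginary quadratic fields is false (witness `N = 3`,
`K = CyclotomicField 3 ℚ = ℚ(√−3)`, where `3` ramifies): `SatisfiesHeegnerHypothesis` is a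
definition to be *assumed* (`hH : SatisfiesHeegnerHypothesis N K`, Gross 1991, §1; Darmon 2004,
Hypothesis 3.9), not a named fact admitting a discharge; companion of
`Literature.NumberTheory.EllipticCurves.not_forall_isImaginaryQuadratic`. [folklore] -/
theorem not_forall_satisfiesHeegnerHypothesis :
    ¬ ∀ (N : ℕ) (K : Type) [Field K] [NumberField K],
      0 < N → IsImaginaryQuadratic K → SatisfiesHeegnerHypothesis N K := by
  intro h
  obtain ⟨K, _, _, hK, -, h3⟩ := exists_isImaginaryQuadratic_and_not_satisfiesHeegnerHypothesis
  exact h3 (h 3 K (by norm_num) hK)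

end Literature.NumberTheory.EllipticCurves

end
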